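import Summits.QuantumFields.GaugeBoot.DiagonalRPTorusRestPartition
import HarnessLib

/-!
# Seed-connected resummation, entropy and ratio bounds for the back expansion (gauge-boot, L3 uniform window, 3a/6)

HONEST FRAMING (cell `pub-gaugeboot`, page 1 of every file): the venture produces certified bounds
on lattice expectations at stated coupling, gauge group, dimension and torus size; NOT a mass gap,
NOT a continuum limit, NOT a string tension; NOT Yang–Mills-summit-bearing (barriers
`FixedCouplingUltralocality`, `PerturbativeInvisibility`). This module is bookkeeping for a
structural NEGATIVE result (a coupling window UNIFORM in the torus size for the failure of
diagonal reflection positivity on `(ℤ/L)^d`, `d ≥ 4`); it discharges nothing by itself.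

## Content (torus `(ℤ/L)^d`, `d ≥ 1`, `L ≥ 1`, compact metrisable `G`, continuous `ρ`, `β ≥ 0`)

The expansions of `DiagonalRPTorusInnerHalfNegativeHighDim` (even `L`, tubes of `8` faces) and
`DiagonalRPTorusClosedHalfNegativeHighDim` (odd `L`, rings of `4` faces) write the trick form of a
plaquette-pair witness as `Σ_{Q ⊆ R} combo(Q)`,
`combo(Q) = T_Q(u₁,v₁) - T_Q(u₁,v₂) - T_Q(u₂,v₁) + T_Q(u₂,v₂)` over the REST plaquettes `R`, and
bound the terms with `|Q| > n` by `2^{#R} · 4N² (2βN)^{n+1}` — a window `β₀(L)` shrinking like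
`2^{-#plaquettes}`. Here the same sum is RESUMMED (no cluster expansion, no logarithms):

* **`sum_combo_eq_sum_seedConn`** — `Σ_{Q ⊆ R} combo(Q) = Σ_{Q₁} combo(Q₁) · restZ(R ∖ N[Q₁])`,
  the sum running over the plaquette sets `Q₁ ⊆ R` every component of which touches a link of
  the four observable plaquettes (`Polymer.IsSeedConn`, seeds `Touch K`,
  `K = links of u₁, u₂, v₁, v₂`), `N[Q₁]` the seeded neighbourhood
  (`Polymer.sum_powerset_eq_sum_seedConn` + the factorisation `sum_pairT_union_eq`): the
  detached plaquettes resum into POSITIVE partial partition functions.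
* the two inputs of the `L`-independent estimate of `DiagonalRPTorusUniformEstimate`:
  the RATIO BOUNDS **`exp_mul_restZ_le_restZ_off`** / **`restZ_off_le`**
  (`restZ(R ∖ N[Q₁]) / restZ(R) ∈ [e^{-(32+8n)d²βN}, e^{32d²βN} (e^{8d²βN})^{#Q₁}]` for `#Q₁ ≤ n`,
  from `#N[Q₁] ≤ 32d² + 8d² #Q₁`, `card_snbhd_le`), and the ENTROPY BOUND **`entropy_le`**
  (`Σ_{Q₁ ⊆ R seed-connected} (1/(24d²))^{#Q₁} ≤ e⁴`, uniformly in `R`, by the tree's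
  Peierls–Kotecký–Preiss bounds `Polymer.sum_isConn_pow_card_le` /
  `Polymer.sum_isSeedConn_pow_card_le` with degree `8d²`, activity `1/(24d²) ≤ 1/(8e d²)`, at most
  `32d²` seeds).

Sources for the mechanism: Osterwalder–Seiler, Ann. Phys. 110 (1978) 440, §3; Friedli–Velenik
(2017) §5.2. Elementary; no named fact.
-/

open MeasureTheory Finset Function

namespace Summit.QuantumFields.GaugeBoot

open Literature.MathematicalPhysics.QuantumFieldTheory

noncomputable section

namespace DiagRPUnif

open DiagRPTube

variable {d L : ℕ} [NeZero L] {N : ℕ} {G : Type*} [Group G] [TopologicalSpace G]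
  [IsTopologicalGroup G] [CompactSpace G] [MeasurableSpace G] [BorelSpace G]
  [SecondCountableTopology G] (ρ : G →* Matrix (Fin N) (Fin N) ℂ) (β : ℝ)

/-! ## The four observable plaquettes, their links, the combination -/

/-- The links of the four observable plaquettes (the SEED LINKS). -/
def seedLinks (u₁ u₂ v₁ v₂ : Plaquette d L) : Finset (Edge d L) :=
  plinks u₁ ∪ plinks u₂ ∪ plinks v₁ ∪ plinks v₂

/-- The signed combination of the four pair terms:
`combo Q = T_Q(u₁,v₁) - T_Q(u₁,v₂) - T_Q(u₂,v₁) + T_Q(u₂,v₂)`. -/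
def combo (u₁ u₂ v₁ v₂ : Plaquette d L) (Q : Finset (Plaquette d L)) : ℝ :=
  pairT ρ β Q u₁ v₁ - pairT ρ β Q u₁ v₂ - pairT ρ β Q u₂ v₁ + pairT ρ β Q u₂ v₂

section Seeds

variable (u₁ u₂ v₁ v₂ : Plaquette d L)

omit [NeZero L] in
/-- There are at most `16` seed links. -/
theorem card_seedLinks_le : (seedLinks u₁ u₂ v₁ v₂).card ≤ 16 := by
  unfold seedLinks
  refine (card_union_le _ _).trans ?_
  refine (Nat.add_le_add_right ((card_union_le _ _).trans (Nat.add_le_add_right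
    ((card_union_le _ _).trans (Nat.add_le_add (card_plinks_le u₁) (card_plinks_le u₂))) _)) _).trans ?_
  have h3 := card_plinks_le v₁
  have h4 := card_plinks_le v₂
  omega

omit [NeZero L] in
/-- The links of `u₁` are seed links. -/
theorem plinks_u₁_subset : plinks u₁ ⊆ seedLinks u₁ u₂ v₁ v₂ :=
  subset_union_left.trans (subset_union_left.trans subset_union_left)

omit [NeZero L] in
/-- The links of `u₂` are seed links. -/
theorem plinks_u₂_subset : plinks u₂ ⊆ seedLinks u₁ u₂ v₁ v₂ :=
  subset_union_right.trans (subset_union_left.trans subset_union_left)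

omit [NeZero L] in
/-- The links of `v₁` are seed links. -/
theorem plinks_v₁_subset : plinks v₁ ⊆ seedLinks u₁ u₂ v₁ v₂ :=
  subset_union_right.trans subset_union_left

omit [NeZero L] in
/-- The links of `v₂` are seed links. -/
theorem plinks_v₂_subset : plinks v₂ ⊆ seedLinks u₁ u₂ v₁ v₂ := subset_union_right

omit [NeZero L] in
/-- A set all of whose plaquettes touch the seeds is seed-connected. -/
theorem isSeedConn_of_touch {K : Finset (Edge d L)} {M : Finset (Plaquette d L)}
    (hM : ∀ q ∈ M, Touch K q) : Polymer.IsSeedConn padj (Touch K) M :=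
  fun b hb => ⟨b, hb, hM b hb, Polymer.Reach.refl b⟩

/-- At most `32d²` plaquettes touch the seed links (in any region). -/
theorem card_seeds_le (P : Finset (Plaquette d L)) :
    (P.filter (Touch (seedLinks u₁ u₂ v₁ v₂))).card ≤ 32 * d ^ 2 :=
  (card_filter_touch_le _ P).trans ((Nat.mul_le_mul_right _ (card_seedLinks_le u₁ u₂ v₁ v₂)).trans
    (by ring_nf; exact le_rfl))

/-- The plaquettes switched off around `Q₁` are at most `32d² + 8d² #Q₁`. -/
theorem card_off_le (P Q₁ : Finset (Plaquette d L)) :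
    (P \ (P \ Polymer.snbhd padj (Touch (seedLinks u₁ u₂ v₁ v₂)) P Q₁)).card ≤
      32 * d ^ 2 + Q₁.card * (8 * d ^ 2) :=
  (card_sdiff_sdiff_snbhd_le _ P Q₁).trans (Nat.add_le_add_right
    ((Nat.mul_le_mul_right _ (card_seedLinks_le u₁ u₂ v₁ v₂)).trans (by ring_nf; exact le_rfl)) _)

end Seeds

/-! ## The resummed expansion -/

section Resum

variable (u₁ u₂ v₁ v₂ : Plaquette d L) (R : Finset (Plaquette d L))

open Classical in
/-- ★ **The resummed expansion**:
`Σ_{Q ⊆ R} combo(Q) = Σ_{Q₁ ⊆ R seed-connected} combo(Q₁) · restZ(R ∖ N[Q₁])`. -/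
theorem sum_combo_eq_sum_seedConn (hρ : Continuous ρ) :
    ∑ Q ∈ R.powerset, combo ρ β u₁ u₂ v₁ v₂ Q =
      ∑ Q₁ ∈ R.powerset.filter (Polymer.IsSeedConn padj (Touch (seedLinks u₁ u₂ v₁ v₂))),
        combo ρ β u₁ u₂ v₁ v₂ Q₁ *
          restZ ρ β (R \ Polymer.snbhd padj (Touch (seedLinks u₁ u₂ v₁ v₂)) R Q₁) := by
  rw [Polymer.sum_powerset_eq_sum_seedConn (adj := padj) (s := Touch (seedLinks u₁ u₂ v₁ v₂)) R]
  refine sum_congr rfl fun Q₁ hQ₁ => ?_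
  have hQ₁R : Q₁ ⊆ R := mem_powerset.1 (mem_filter.1 hQ₁).1
  have h11 := sum_pairT_union_eq ρ β hρ (P := R) hQ₁R (plinks_u₁_subset u₁ u₂ v₁ v₂)
    (plinks_v₁_subset u₁ u₂ v₁ v₂)
  have h12 := sum_pairT_union_eq ρ β hρ (P := R) hQ₁R (plinks_u₁_subset u₁ u₂ v₁ v₂)
    (plinks_v₂_subset u₁ u₂ v₁ v₂)
  have h21 := sum_pairT_union_eq ρ β hρ (P := R) hQ₁R (plinks_u₂_subset u₁ u₂ v₁ v₂)
    (plinks_v₁_subset u₁ u₂ v₁ v₂)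
  have h22 := sum_pairT_union_eq ρ β hρ (P := R) hQ₁R (plinks_u₂_subset u₁ u₂ v₁ v₂)
    (plinks_v₂_subset u₁ u₂ v₁ v₂)
  unfold combo
  rw [sum_add_distrib, sum_sub_distrib, sum_sub_distrib, h11, h12, h21, h22]
  ring

end Resum

/-! ## The entropy of the seed-connected sets -/

section Entropy

variable (u₁ u₂ v₁ v₂ : Plaquette d L) (R : Finset (Plaquette d L))

open Classical in
/-- ★ **Entropy bound**: with the activity `y₀ = 1/(24 d²)`,
`Σ_{Q₁ ⊆ R seed-connected} y₀^{#Q₁} ≤ e⁴`, uniformly in `R` (Peierls–Kotecký–Preiss with degree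
`8d²`, `θ = 1/(8d²)`, at most `32d²` seeds). -/
theorem entropy_le (hd : 1 ≤ d) :
    ∑ Q₁ ∈ R.powerset.filter (Polymer.IsSeedConn padj (Touch (seedLinks u₁ u₂ v₁ v₂))),
        (1 / (24 * (d : ℝ) ^ 2)) ^ Q₁.card ≤ Real.exp 4 := by
  have hd' : (1 : ℝ) ≤ d := by exact_mod_cast hd
  have hd2 : 0 < (d : ℝ) ^ 2 := by positivity
  have hconn : ∀ a ∈ R.filter (Touch (seedLinks u₁ u₂ v₁ v₂)),
      ∑ C ∈ R.powerset.filter (fun C => Polymer.IsConn padj C a),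
        (1 / (24 * (d : ℝ) ^ 2)) ^ C.card ≤ 1 / (8 * (d : ℝ) ^ 2) := by
    intro a _
    refine Polymer.sum_isConn_pow_card_le (adj := padj) (8 * d ^ 2)
      (fun a P => card_filter_padj_le a P) (by positivity) ?_ R a
    have h1 : ((8 * d ^ 2 : ℕ) : ℝ) * (1 / (8 * (d : ℝ) ^ 2)) = 1 := by
      push_cast
      field_simp
    rw [h1, le_div_iff₀ (by positivity)]
    have h2 : 1 / (24 * (d : ℝ) ^ 2) * Real.exp 1 * (8 * (d : ℝ) ^ 2) = Real.exp 1 / 3 := by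
      field_simp
      ring
    rw [h2]
    have he3 : Real.exp 1 ≤ 3 := by
      have h := Real.exp_one_lt_d9; norm_num at h; linarith
    linarith
  have hgas := Polymer.sum_isSeedConn_pow_card_le (adj := padj)
    (s := Touch (seedLinks u₁ u₂ v₁ v₂)) (y := 1 / (24 * (d : ℝ) ^ 2)) (θ := 1 / (8 * (d : ℝ) ^ 2))
    (by positivity) R hconn
  refine hgas.trans (Real.exp_le_exp.2 ?_)
  have hs : ((R.filter (Touch (seedLinks u₁ u₂ v₁ v₂))).card : ℝ) ≤ 32 * (d : ℝ) ^ 2 := by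
    exact_mod_cast card_seeds_le u₁ u₂ v₁ v₂ R
  calc ((R.filter (Touch (seedLinks u₁ u₂ v₁ v₂))).card : ℝ) * (1 / (8 * (d : ℝ) ^ 2))
      ≤ 32 * (d : ℝ) ^ 2 * (1 / (8 * (d : ℝ) ^ 2)) :=
        mul_le_mul_of_nonneg_right hs (by positivity)
    _ = 4 := by field_simp; ring

end Entropy

/-! ## The partition-function ratios -/

section Ratios

variable {u₁ u₂ v₁ v₂ : Plaquette d L} {R : Finset (Plaquette d L)}

/-- **Lower ratio bound**: switching off the neighbourhood of a set of at most `n` plaquettes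
costs at most `e^{(32+8n)d² βN}`: `e^{-(32+8n)d² βN} restZ(R) ≤ restZ(R ∖ N[Q₁])`. -/
theorem exp_mul_restZ_le_restZ_off (hρ : Continuous ρ) (hβ : 0 ≤ β) {n : ℕ}
    {Q₁ : Finset (Plaquette d L)} (hQ₁n : Q₁.card ≤ n) :
    Real.exp (-((32 + 8 * n) * (d : ℝ) ^ 2 * (β * N))) * restZ ρ β R ≤
      restZ ρ β (R \ Polymer.snbhd padj (Touch (seedLinks u₁ u₂ v₁ v₂)) R Q₁) := by
  set V := R \ Polymer.snbhd padj (Touch (seedLinks u₁ u₂ v₁ v₂)) R Q₁ with hV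
  have hVR : V ⊆ R := sdiff_subset
  have h1 := restZ_le_exp_mul_restZ_of_subset ρ β hρ hVR
  have hc : ((R \ V).card : ℝ) ≤ 32 * (d : ℝ) ^ 2 + n * (8 * (d : ℝ) ^ 2) := by
    have h := card_off_le u₁ u₂ v₁ v₂ R Q₁
    have h' : ((R \ V).card : ℝ) ≤ 32 * (d : ℝ) ^ 2 + Q₁.card * (8 * (d : ℝ) ^ 2) := by
      rw [hV]; exact_mod_cast h
    have hq : (Q₁.card : ℝ) ≤ n := by exact_mod_cast hQ₁n
    have hd2 : (0 : ℝ) ≤ 8 * (d : ℝ) ^ 2 := by positivity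
    nlinarith [mul_le_mul_of_nonneg_right hq hd2]
  have hβN0 : 0 ≤ β * N := mul_nonneg hβ (Nat.cast_nonneg N)
  have he : Real.exp (|β| * N * (R \ V).card) ≤ Real.exp ((32 + 8 * n) * (d : ℝ) ^ 2 * (β * N)) := by
    rw [abs_of_nonneg hβ, Real.exp_le_exp]
    calc β * N * (R \ V).card ≤ β * N * (32 * (d : ℝ) ^ 2 + n * (8 * (d : ℝ) ^ 2)) :=
          mul_le_mul_of_nonneg_left hc hβN0
      _ = (32 + 8 * n) * (d : ℝ) ^ 2 * (β * N) := by ring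
  have hZV : 0 ≤ restZ ρ β V := (restZ_pos ρ β hρ V).le
  have h2 : restZ ρ β R ≤ Real.exp ((32 + 8 * n) * (d : ℝ) ^ 2 * (β * N)) * restZ ρ β V :=
    h1.trans (mul_le_mul_of_nonneg_right he hZV)
  have h3 : Real.exp (-((32 + 8 * n) * (d : ℝ) ^ 2 * (β * N))) *
      Real.exp ((32 + 8 * n) * (d : ℝ) ^ 2 * (β * N)) = 1 := by
    rw [← Real.exp_add, neg_add_cancel, Real.exp_zero]
  calc Real.exp (-((32 + 8 * n) * (d : ℝ) ^ 2 * (β * N))) * restZ ρ β R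
      ≤ Real.exp (-((32 + 8 * n) * (d : ℝ) ^ 2 * (β * N))) *
          (Real.exp ((32 + 8 * n) * (d : ℝ) ^ 2 * (β * N)) * restZ ρ β V) :=
        mul_le_mul_of_nonneg_left h2 (Real.exp_nonneg _)
    _ = restZ ρ β V := by rw [← mul_assoc, h3, one_mul]

/-- **Upper ratio bound**: `restZ(R ∖ N[Q₁]) ≤ e^{32d²βN} (e^{8d²βN})^{#Q₁} restZ(R)`. -/
theorem restZ_off_le (hρ : Continuous ρ) (hβ : 0 ≤ β) (Q₁ : Finset (Plaquette d L)) :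
    restZ ρ β (R \ Polymer.snbhd padj (Touch (seedLinks u₁ u₂ v₁ v₂)) R Q₁) ≤
      Real.exp (32 * (d : ℝ) ^ 2 * (β * N)) * Real.exp (8 * (d : ℝ) ^ 2 * (β * N)) ^ Q₁.card *
        restZ ρ β R := by
  set V := R \ Polymer.snbhd padj (Touch (seedLinks u₁ u₂ v₁ v₂)) R Q₁ with hV
  have hVR : V ⊆ R := sdiff_subset
  have h1 := restZ_le_exp_mul_restZ_of_superset ρ β hρ hVR
  have hc : ((R \ V).card : ℝ) ≤ 32 * (d : ℝ) ^ 2 + Q₁.card * (8 * (d : ℝ) ^ 2) := by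
    rw [hV]; exact_mod_cast card_off_le u₁ u₂ v₁ v₂ R Q₁
  have hβN0 : 0 ≤ β * N := mul_nonneg hβ (Nat.cast_nonneg N)
  have he : Real.exp (|β| * N * (R \ V).card) ≤
      Real.exp (32 * (d : ℝ) ^ 2 * (β * N)) * Real.exp (8 * (d : ℝ) ^ 2 * (β * N)) ^ Q₁.card := by
    rw [← Real.exp_nat_mul, ← Real.exp_add, abs_of_nonneg hβ, Real.exp_le_exp]
    calc β * N * (R \ V).card ≤ β * N * (32 * (d : ℝ) ^ 2 + Q₁.card * (8 * (d : ℝ) ^ 2)) :=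
          mul_le_mul_of_nonneg_left hc hβN0
      _ = 32 * (d : ℝ) ^ 2 * (β * N) + Q₁.card * (8 * (d : ℝ) ^ 2 * (β * N)) := by ring
  exact h1.trans (mul_le_mul_of_nonneg_right he (restZ_pos ρ β hρ R).le)

end Ratios

end DiagRPUnif

end

end Summit.QuantumFields.GaugeBoot
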